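import Summits.CriticalPhenomena.PercolationContinuityZ3.Theorems.PercNearOneGluingNoHeavyLowerTailSunflowerMultiPetalKempeMarkedUnpairedStep
import HarnessLib
import HarnessLib.Audit

/-!
# `NoHeavyLowerTail` (crux stmt-CriticalPhenomena-4575), marked-multigraph layer: THEOREM U ROW BY ROW (the filtered unpaired step law)

Support file (seat `prim-l12-p2` gen 54; `--supports stmt-CriticalPhenomena-4575`; sequel of `…KempeMarkedUnpairedStep`).  No `sorry`; nothing is asserted
about the crux.  Memo: run/shared/lean/prim/prim-l12/prim-l12-p2/FINDING-g54-UNPAIRED-ALL-D-LAW.md §1, §3; FINDING-g53-UNPAIRED-STEP-LAWS.md §1.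

THEOREM U (`TfunM_step_unpaired`) bounds SUMS over all terminal-coloured colourings.  Its proof is UNPAIRED: no colouring is ever compared with a
colouring that differs off `S ∪ {y}`.  This file records that fact as a theorem: for every predicate `Φ` on colourings that ignores the colours on `S ∪ {y}`
(e.g. 'the colouring restricted to the far vertices is a fixed pattern' = ONE ROW of the expansion, or 'exactly `i` of the special points `P` are coloured `0`
and `j` of `Q` are coloured `1`' = one weight class of the fractional-mark functional `TI_{P,Q}`), the law holds for the `Φ`-FILTERED functional
`T_Φ(L) = Σ_{σ u = 0, σ v = 1, Φ σ} fC(type_L σ)` of all five graphs at once: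
* `TfunF`, `sum_kerTAbs_filter` (filtered one-point expansion `Σ_{Φ} kerTAbs = 3·T_Φ(K) − T_Φ(K.isolate y)`), the filtered kernel sums and their graph
  identifications `TfunF_peelContract`, `TfunF_blockGraph`, `TfunF_uvGraph`, the filtered heart `sum_resU2_filter_nonneg`;
* **`TfunF_step_unpaired`**: `2·3^{|S|}·T_Φ(K.isolate y) + 2·T_Φ(K.peelContract y S u) + 6·T_Φ((K.peelContract y (S∖w) w)⁺ᵘ) + Σ_s T_Φ((K.peelContract y (S∖s) u)/sv)
  ≤ 2·3^{|S|+1}·T_Φ(K)` for every such `Φ` — the transfer principle of FINDING-g53 §1 in kernel-checkable form (summing over the weight classes of `TI_{P,Q}`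
  with weights `2^{−i−j}` is the sequel).
-/

namespace Summit.CriticalPhenomena.PercolationContinuityZ3.Theorems.SunflowerPartition.Kempe

open Finset

namespace MGraph

variable {V : Type*} [Fintype V] [LinearOrder V] (K : MGraph V)

section Filter

variable (Φ : (V → Fin 3) → Prop) [DecidablePred Φ]

/-- The `Φ`-FILTERED two-terminal functional `T_Φ(K;u,v) = Σ_{σ u = 0, σ v = 1, Φ σ} fC (type σ)`. [this work] -/
def TfunF (u v : V) : ℤ := ∑ σ ∈ univ.filter (fun σ : V → Fin 3 => (σ u = 0 ∧ σ v = 1) ∧ Φ σ), fC (K.ctypeM σ)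

/-- Filtered all-`0` kernel sum. [this work] -/
def allZeroSumF (y : V) (S : Finset V) (u v : V) : ℤ :=
  ∑ ρ ∈ univ.filter (fun ρ : V → Fin 3 => (ρ u = 0 ∧ ρ v = 1) ∧ Φ ρ), (if ∀ s ∈ S, ρ s = 0 then fC ((K.isolate y).ctypeM ρ) else 0)

/-- Filtered block kernel sum. [this work] -/
def blockSumF (y : V) (S : Finset V) (u v : V) : ℤ :=
  ∑ ρ ∈ univ.filter (fun ρ : V → Fin 3 => (ρ u = 0 ∧ ρ v = 1) ∧ Φ ρ),
    (if (∀ s ∈ S, ρ s = 0) ∨ (∀ s ∈ S, ρ s = 1) ∨ (∀ s ∈ S, ρ s = 2) then fC (ctAdd ((K.isolate y).ctypeM ρ) (1, 0, 0)) else 0)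

/-- Filtered double-merge kernel sum at `s`. [this work] -/
def uvSumF (y : V) (S : Finset V) (s u v : V) : ℤ :=
  ∑ ρ ∈ univ.filter (fun ρ : V → Fin 3 => (ρ u = 0 ∧ ρ v = 1) ∧ Φ ρ),
    (if ρ s = 1 ∧ (∀ s' ∈ S, s' ≠ s → ρ s' = 0) then fC ((K.isolate y).ctypeM ρ) else 0)

/-- **Filtered one-point expansion**: `Σ_{Φ-cells} kerTAbs (type_{K−y} ρ) (profile_y ρ) = 3·T_Φ(K) − T_Φ(K.isolate y)` when `Φ` ignores the colour of `y`. [this work] -/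
theorem sum_kerTAbs_filter (y u v : V) (huy : u ≠ y) (hvy : v ≠ y) (hΦ : ∀ σ c, Φ (Function.update σ y c) ↔ Φ σ) :
    ∑ ρ ∈ univ.filter (fun ρ : V → Fin 3 => (ρ u = 0 ∧ ρ v = 1) ∧ Φ ρ), kerTAbs ((K.isolate y).ctypeM ρ) (K.profM y ρ)
      = 3 * K.TfunF Φ u v - (K.isolate y).TfunF Φ u v := by
  set P := (fun ρ : V → Fin 3 => (ρ u = 0 ∧ ρ v = 1) ∧ Φ ρ) with hP
  have hPy : ∀ σ c, P (Function.update σ y c) ↔ P σ := fun σ c => by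
    simp only [hP, Function.update_of_ne huy, Function.update_of_ne hvy, hΦ σ c]
  have hfree := K.isFree_isolate_self y
  -- each colour-c column of the kernel is 3·(the c-fibre of T_Φ(K))
  have hcol : ∀ c : Fin 3, ∑ ρ ∈ univ.filter P, fC (ctAdd ((K.isolate y).ctypeM ρ) (xPart c (K.profM y ρ)))
      = 3 * ∑ ρ ∈ univ.filter (fun ρ => P ρ ∧ ρ y = c), fC (K.ctypeM ρ) := by
    intro c
    have h1 : ∀ ρ : V → Fin 3, fC (ctAdd ((K.isolate y).ctypeM ρ) (xPart c (K.profM y ρ))) = fC (K.ctypeM (Function.update ρ y c)) := by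
      intro ρ
      rw [K.ctypeM_eq_ctAdd_isolate y (Function.update ρ y c), Function.update_self,
        (K.isolate y).ctypeM_update_of_isFree hfree ρ c, K.profM_update_self y ρ c]
    rw [sum_congr rfl (fun ρ _ => h1 ρ)]
    rw [sum_filter_eq_three_mul y P hPy (fun ρ => fC (K.ctypeM (Function.update ρ y c)))
      (fun σ c' => by simp only [Function.update_idem]) (fun _ => c) (fun _ _ => rfl)]
    congr 1
    refine sum_congr rfl fun ρ hρ => ?_
    have hy : ρ y = c := ((mem_filter.1 hρ).2).2
    rw [← hy, Function.update_eq_self]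
  have hsplit : K.TfunF Φ u v = ∑ c : Fin 3, ∑ ρ ∈ univ.filter (fun ρ => P ρ ∧ ρ y = c), fC (K.ctypeM ρ) := by
    have e0 : K.TfunF Φ u v = ∑ σ ∈ univ.filter P, fC (K.ctypeM σ) := rfl
    rw [e0, ← sum_fiberwise (univ.filter P) (fun σ => σ y) (fun σ => fC (K.ctypeM σ))]
    refine sum_congr rfl fun c _ => sum_congr ?_ fun _ _ => rfl
    ext σ
    simp only [mem_filter, mem_univ, true_and]
  have eiso : (K.isolate y).TfunF Φ u v = ∑ σ ∈ univ.filter P, fC ((K.isolate y).ctypeM σ) := rfl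
  unfold kerTAbs
  rw [sum_sub_distrib, sum_add_distrib, sum_add_distrib, hcol 0, hcol 1, hcol 2, hsplit, Fin.sum_univ_three, eiso]
  ring

/-- **Filtered unpaired cell identity**: `Σ_{Φ-cells} resU2 = 2·(3·T_Φ(K) − T_Φ(K.isolate y) − allZeroSumF) − 2·blockSumF − Σ_s uvSumF s`. [this work] -/
theorem sum_resU2_filter_eq (y : V) (S : Finset V) (u v : V) (huy : u ≠ y) (hvy : v ≠ y) (hΦ : ∀ σ c, Φ (Function.update σ y c) ↔ Φ σ) :
    ∑ ρ ∈ univ.filter (fun ρ : V → Fin 3 => (ρ u = 0 ∧ ρ v = 1) ∧ Φ ρ), K.resU2 y S ρ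
      = 2 * ((3 * K.TfunF Φ u v - (K.isolate y).TfunF Φ u v) - K.allZeroSumF Φ y S u v)
        - 2 * K.blockSumF Φ y S u v - ∑ s ∈ S, K.uvSumF Φ y S s u v := by
  have h := K.sum_kerTAbs_filter Φ y u v huy hvy hΦ
  unfold resU2 resCell allZeroSumF blockSumF uvSumF
  rw [sum_sub_distrib, sum_sub_distrib, ← mul_sum, ← mul_sum, sum_sub_distrib, h, sum_comm]

end Filter

/-! ## The filtered heart and the filtered kernels as `T_Φ` of minors -/

section FilterHeart

variable {K}
variable {u v y : V} {S : Finset V}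
variable (Φ : (V → Fin 3) → Prop) [DecidablePred Φ]

/-- **Filtered heart**: for `Φ` ignoring the colours on `S`, the unpaired residuals sum to `≥ 0` over every `Φ`-class (the D4 → sibling charge stays inside
the class). [this work] -/
theorem sum_resU2_filter_nonneg (hS : ∀ w, w ∈ S ↔ (w ≠ u ∧ w ≠ v ∧ w ≠ y ∧ K.mul y w ≠ 0)) (huv : u ≠ v) (hyu : y ≠ u) (hyv : y ≠ v)
    (hmy : K.mark y = 0) (hyu' : K.mul y u ≠ 0) (hv0 : K.mul y v = 0) (htwo : 2 ≤ S.card)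
    (hΦS : ∀ s ∈ S, ∀ σ c, Φ (Function.update σ s c) ↔ Φ σ) :
    0 ≤ ∑ ρ ∈ univ.filter (fun ρ : V → Fin 3 => (ρ u = 0 ∧ ρ v = 1) ∧ Φ ρ), K.resU2 y S ρ := by
  set F := univ.filter (fun ρ : V → Fin 3 => (ρ u = 0 ∧ ρ v = 1) ∧ Φ ρ) with hF
  set D := F.filter (fun ρ => K.resU2 y S ρ < 0) with hD
  have memF : ∀ ρ, ρ ∈ F ↔ (ρ u = 0 ∧ ρ v = 1) ∧ Φ ρ := fun ρ => by rw [hF, mem_filter]; simp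
  have hDval : ∀ ρ ∈ D, K.resU2 y S ρ = -2 := fun ρ hρ => by
    rw [hD, mem_filter] at hρ
    exact (resU2_neg_cases hS huv hyu hyv hmy hyu' hv0 htwo ρ ((memF ρ).1 hρ.1).1.1 ((memF ρ).1 hρ.1).1.2 hρ.2).2
  have hpay : ∀ ρ ∈ D, sibU S ρ ∈ F ∧ 2 ≤ K.resU2 y S (sibU S ρ) := by
    intro ρ hρ
    rw [hD, mem_filter] at hρ
    obtain ⟨⟨hu, hv⟩, hΦρ⟩ := (memF ρ).1 hρ.1
    obtain ⟨⟨s₀, hs₀, hc₀, hm₀, hrest, -, ht⟩, -⟩ := resU2_neg_cases hS huv hyu hyv hmy hyu' hv0 htwo ρ hu hv hρ.2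
    obtain ⟨hs₀u, hs₀v, -, -⟩ := (hS s₀).1 hs₀
    rw [sibU_of_D4 ρ hs₀ hc₀ hrest]
    exact ⟨(memF _).2 ⟨⟨by rw [Function.update_of_ne hs₀u.symm, hu], by rw [Function.update_of_ne hs₀v.symm, hv]⟩, (hΦS s₀ hs₀ ρ 1).2 hΦρ⟩,
      two_le_resU2_sibling_of_D4 hS huv hyu hyv hmy hyu' htwo ρ hu hv hs₀ hc₀ hm₀ hrest hv0 ht⟩
  have hinj : Set.InjOn (sibU S) D := by
    intro ρ₁ h₁ ρ₂ h₂ heq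
    rw [mem_coe, hD, mem_filter] at h₁ h₂
    obtain ⟨⟨hu₁, hv₁⟩, -⟩ := (memF ρ₁).1 h₁.1
    obtain ⟨⟨hu₂, hv₂⟩, -⟩ := (memF ρ₂).1 h₂.1
    obtain ⟨⟨s₁, hs₁, c₁, -, r₁, -, -⟩, -⟩ := resU2_neg_cases hS huv hyu hyv hmy hyu' hv0 htwo ρ₁ hu₁ hv₁ h₁.2
    obtain ⟨⟨s₂, hs₂, c₂, -, r₂, -, -⟩, -⟩ := resU2_neg_cases hS huv hyu hyv hmy hyu' hv0 htwo ρ₂ hu₂ hv₂ h₂.2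
    rw [sibU_of_D4 ρ₁ hs₁ c₁ r₁, sibU_of_D4 ρ₂ hs₂ c₂ r₂] at heq
    have hs : s₁ = s₂ := by
      by_contra hne
      have h := congrFun heq s₁
      rw [Function.update_self, Function.update_of_ne hne, r₂ s₁ hs₁ hne] at h
      exact absurd h (by decide)
    subst hs
    funext w
    by_cases hw : w = s₁
    · rw [hw, c₁, c₂]
    · have h := congrFun heq w
      rwa [Function.update_of_ne hw, Function.update_of_ne hw] at h
  have hDsub : D ⊆ F := filter_subset _ _
  have hsplit : ∑ ρ ∈ F, K.resU2 y S ρ = ∑ ρ ∈ D, K.resU2 y S ρ + ∑ ρ ∈ F \ D, K.resU2 y S ρ := by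
    rw [← sum_sdiff hDsub, add_comm]
  have hDsum : ∑ ρ ∈ D, K.resU2 y S ρ = -2 * (D.card : ℤ) := by
    rw [sum_congr rfl hDval, sum_const]; simp; ring
  have himg_sub : D.image (sibU S) ⊆ F \ D := by
    intro σ hσ
    rw [mem_image] at hσ
    obtain ⟨ρ, hρ, rfl⟩ := hσ
    obtain ⟨hF1, h1⟩ := hpay ρ hρ
    rw [mem_sdiff]
    refine ⟨hF1, fun hmem => ?_⟩
    have hlt : K.resU2 y S (sibU S ρ) < 0 := by
      simp only [hD, mem_filter] at hmem; exact hmem.2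
    omega
  have hrest_nonneg : ∀ ρ ∈ F \ D, 0 ≤ K.resU2 y S ρ := fun ρ hρ => by
    have hρF := (mem_sdiff.1 hρ).1
    have hρD := (mem_sdiff.1 hρ).2
    by_contra hlt; push Not at hlt
    exact hρD (by simp only [hD, mem_filter]; exact ⟨hρF, hlt⟩)
  have h2 : ∑ σ ∈ D.image (sibU S), K.resU2 y S σ ≤ ∑ ρ ∈ F \ D, K.resU2 y S ρ :=
    sum_le_sum_of_subset_of_nonneg himg_sub (fun ρ hρ _ => hrest_nonneg ρ hρ)
  have h3 : 2 * ((D.image (sibU S)).card : ℤ) ≤ ∑ σ ∈ D.image (sibU S), K.resU2 y S σ := by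
    rw [card_eq_sum_ones, Nat.cast_sum, mul_sum]
    refine sum_le_sum fun σ hσ => ?_
    rw [mem_image] at hσ
    obtain ⟨ρ, hρ, rfl⟩ := hσ
    simpa using (hpay ρ hρ).2
  have h4 : (D.image (sibU S)).card = D.card := card_image_of_injOn hinj
  rw [hsplit, hDsum]
  have : 2 * (D.card : ℤ) ≤ ∑ ρ ∈ F \ D, K.resU2 y S ρ := by
    calc 2 * (D.card : ℤ) = 2 * ((D.image (sibU S)).card : ℤ) := by rw [h4]
      _ ≤ _ := h3
      _ ≤ _ := h2
  linarith

variable (K) (y u v : V) (S : Finset V)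

/-- `T_Φ(K.peelContract y S u) = 3^{|S|}·allZeroSumF` for `Φ` ignoring the colours on `S`. [this work] -/
theorem TfunF_peelContract (huy : u ≠ y) (huS : u ∉ S) (hvS : v ∉ S) (hyS : y ∉ S) (hΦS : ∀ s ∈ S, ∀ σ c, Φ (Function.update σ s c) ↔ Φ σ) :
    (K.peelContract y S u).TfunF Φ u v = 3 ^ S.card * K.allZeroSumF Φ y S u v := by
  set L := K.peelContract y S u with hL
  have hZ : ∀ z ∈ S, L.IsFree z := fun z hz => K.isFree_peelContract_of_mem y u S hz
  have h2 := L.sum_filter_eq_pow_mul fC S hZ (fun σ => (σ u = 0 ∧ σ v = 1) ∧ Φ σ)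
    (fun z hz σ c => by
      have hzu : z ≠ u := fun e => huS (e ▸ hz)
      have hzv : z ≠ v := fun e => hvS (e ▸ hz)
      rw [Function.update_of_ne hzu.symm, Function.update_of_ne hzv.symm, hΦS z hz σ c])
    (fun _ _ => 0) (fun _ _ _ _ _ _ => rfl)
  have h3 : ∑ σ ∈ univ.filter (fun σ : V → Fin 3 => ((σ u = 0 ∧ σ v = 1) ∧ Φ σ) ∧ ∀ z ∈ S, σ z = (0 : Fin 3)), fC (L.ctypeM σ)
      = ∑ σ ∈ univ.filter (fun σ : V → Fin 3 => ((σ u = 0 ∧ σ v = 1) ∧ Φ σ) ∧ ∀ z ∈ S, σ z = (0 : Fin 3)), fC ((K.isolate y).ctypeM σ) := by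
    refine sum_congr rfl fun σ hσ => ?_
    obtain ⟨⟨⟨hu, -⟩, -⟩, hz⟩ := (mem_filter.1 hσ).2
    rw [hL, K.ctypeM_peelContract_of_const y u S huy huS hyS σ (fun z hz' => by rw [hz z hz', hu])]
  have h4 : ∑ σ ∈ univ.filter (fun σ : V → Fin 3 => ((σ u = 0 ∧ σ v = 1) ∧ Φ σ) ∧ ∀ z ∈ S, σ z = (0 : Fin 3)), fC ((K.isolate y).ctypeM σ)
      = K.allZeroSumF Φ y S u v := by
    unfold allZeroSumF
    rw [sum_filter, sum_filter]
    refine sum_congr rfl fun σ _ => ?_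
    by_cases hP : (σ u = 0 ∧ σ v = 1) ∧ Φ σ
    · by_cases hQ : ∀ z ∈ S, σ z = 0
      · rw [if_pos ⟨hP, hQ⟩, if_pos hP, if_pos hQ]
      · rw [if_neg (fun h => hQ h.2), if_pos hP, if_neg hQ]
    · rw [if_neg (fun h => hP h.1), if_neg hP]
  unfold TfunF
  rw [h2, h3, h4]

/-- `T_Φ((K.peelContract y (S∖w) w)⁺ᵘ) = 3^{|S|−1}·blockSumF` for `w ∈ S` and `Φ` ignoring the colours on `S`. [this work] -/
theorem TfunF_blockGraph (huS : u ∉ S) (hvS : v ∉ S) (hyS : y ∉ S) (hΦS : ∀ s ∈ S, ∀ σ c, Φ (Function.update σ s c) ↔ Φ σ)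
    {w : V} (hw : w ∈ S) :
    ((K.peelContract y (S.erase w) w).addMark u 1).TfunF Φ u v = 3 ^ (S.card - 1) * K.blockSumF Φ y S u v := by
  have hwy : w ≠ y := fun e => hyS (e ▸ hw)
  set L := K.peelContract y (S.erase w) w with hL
  have hZ : ∀ z ∈ S.erase w, (L.addMark u 1).IsFree z := fun z hz =>
    L.isFree_addMark u 1 (K.isFree_peelContract_of_mem y w (S.erase w) hz) (fun e => huS (e ▸ (mem_erase.1 hz).2))
  have hcard : (S.erase w).card = S.card - 1 := card_erase_of_mem hw
  have h2 := (L.addMark u 1).sum_filter_eq_pow_mul fC (S.erase w) hZ (fun σ => (σ u = 0 ∧ σ v = 1) ∧ Φ σ)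
    (fun z hz σ c => by
      have hzu : z ≠ u := fun e => huS (e ▸ (mem_erase.1 hz).2)
      have hzv : z ≠ v := fun e => hvS (e ▸ (mem_erase.1 hz).2)
      rw [Function.update_of_ne hzu.symm, Function.update_of_ne hzv.symm, hΦS z (mem_erase.1 hz).2 σ c])
    (fun _ σ => σ w) (fun z hz z' hz' σ c => by rw [Function.update_of_ne (fun e : w = z' => (mem_erase.1 hz').1 e.symm)])
  have h3 : ∑ σ ∈ univ.filter (fun σ : V → Fin 3 => ((σ u = 0 ∧ σ v = 1) ∧ Φ σ) ∧ ∀ z ∈ S.erase w, σ z = σ w), fC ((L.addMark u 1).ctypeM σ)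
      = ∑ σ ∈ univ.filter (fun σ : V → Fin 3 => ((σ u = 0 ∧ σ v = 1) ∧ Φ σ) ∧ ∀ z ∈ S.erase w, σ z = σ w), fC (ctAdd ((K.isolate y).ctypeM σ) (1, 0, 0)) := by
    refine sum_congr rfl fun σ hσ => ?_
    obtain ⟨⟨⟨hu, -⟩, -⟩, hz⟩ := (mem_filter.1 hσ).2
    rw [L.ctypeM_addMark u 1 σ, hu, xPart_zero_mark, hL,
      K.ctypeM_peelContract_of_const y w (S.erase w) hwy (notMem_erase w S) (fun h => hyS ((mem_erase.1 h).2)) σ hz]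
  have h4 : ∑ σ ∈ univ.filter (fun σ : V → Fin 3 => ((σ u = 0 ∧ σ v = 1) ∧ Φ σ) ∧ ∀ z ∈ S.erase w, σ z = σ w), fC (ctAdd ((K.isolate y).ctypeM σ) (1, 0, 0))
      = K.blockSumF Φ y S u v := by
    unfold blockSumF
    rw [sum_filter, sum_filter]
    refine sum_congr rfl fun σ _ => ?_
    have hiff : (∀ z ∈ S.erase w, σ z = σ w) ↔ ((∀ s ∈ S, σ s = 0) ∨ (∀ s ∈ S, σ s = 1) ∨ (∀ s ∈ S, σ s = 2)) := by
      constructor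
      · intro h
        have hall : ∀ s ∈ S, σ s = σ w := fun s hs => by
          by_cases e : s = w
          · rw [e]
          · exact h s (mem_erase.2 ⟨e, hs⟩)
        have tri : ∀ c : Fin 3, c = 0 ∨ c = 1 ∨ c = 2 := by decide
        rcases tri (σ w) with hc | hc | hc
        · exact Or.inl fun s hs => (hall s hs).trans hc
        · exact Or.inr (Or.inl fun s hs => (hall s hs).trans hc)
        · exact Or.inr (Or.inr fun s hs => (hall s hs).trans hc)
      · intro h z hz
        have hzS := (mem_erase.1 hz).2
        rcases h with h | h | h
        · rw [h z hzS, h w hw]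
        · rw [h z hzS, h w hw]
        · rw [h z hzS, h w hw]
    by_cases hP : (σ u = 0 ∧ σ v = 1) ∧ Φ σ
    · rw [if_pos hP]
      by_cases hQ : ∀ z ∈ S.erase w, σ z = σ w
      · rw [if_pos ⟨hP, hQ⟩, if_pos (hiff.1 hQ)]
      · rw [if_neg (fun h => hQ h.2), if_neg (fun h => hQ (hiff.2 h))]
    · rw [if_neg hP, if_neg (fun h => hP h.1)]
  unfold TfunF
  rw [h2, h3, h4, hcard]

/-- `T_Φ((K.peelContract y (S∖s) u).contractOne s v) = 3^{|S|}·uvSumF s` for `s ∈ S` and `Φ` ignoring the colours on `S`. [this work] -/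
theorem TfunF_uvGraph (huy : u ≠ y) (huS : u ∉ S) (hvS : v ∉ S) (hyS : y ∉ S) (hΦS : ∀ s ∈ S, ∀ σ c, Φ (Function.update σ s c) ↔ Φ σ)
    {s : V} (hs : s ∈ S) :
    ((K.peelContract y (S.erase s) u).contractOne s v).TfunF Φ u v = 3 ^ S.card * K.uvSumF Φ y S s u v := by
  have hsu : s ≠ u := fun e => huS (e ▸ hs)
  have hsv : s ≠ v := fun e => hvS (e ▸ hs)
  set L := K.peelContract y (S.erase s) u with hL
  set P := (fun σ : V → Fin 3 => (σ u = 0 ∧ σ v = 1) ∧ Φ σ) with hP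
  have hPs : ∀ σ c, P (Function.update σ s c) ↔ P σ := fun σ c => by
    simp only [hP, Function.update_of_ne hsu.symm, Function.update_of_ne hsv.symm, hΦS s hs σ c]
  -- (1) contract s into v and pin the colour of s to 1
  have h1 : (L.contractOne s v).TfunF Φ u v = 3 * ∑ ρ ∈ univ.filter (fun ρ => P ρ ∧ ρ s = 1), fC (L.ctypeM ρ) := by
    have e0 : (L.contractOne s v).TfunF Φ u v = ∑ ρ ∈ univ.filter P, fC ((L.contractOne s v).ctypeM ρ) := rfl
    rw [e0]
    have e1 : ∀ ρ ∈ univ.filter P, fC ((L.contractOne s v).ctypeM ρ) = fC (L.ctypeM (Function.update ρ s 1)) := by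
      intro ρ hρ
      rw [L.ctypeM_contractOne_update s v hsv ρ, ((mem_filter.1 hρ).2).1.2]
    rw [sum_congr rfl e1, sum_filter_eq_three_mul s P hPs (fun ρ => fC (L.ctypeM (Function.update ρ s 1)))
      (fun σ c' => by simp only [Function.update_idem]) (fun _ => 1) (fun _ _ => rfl)]
    congr 1
    refine sum_congr rfl fun ρ hρ => ?_
    have h1' : ρ s = 1 := ((mem_filter.1 hρ).2).2
    rw [← h1', Function.update_eq_self]
  -- (2) pin the free vertices S.erase s of L to colour 0
  have hZ : ∀ z ∈ S.erase s, L.IsFree z := fun z hz => K.isFree_peelContract_of_mem y u (S.erase s) hz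
  have hcard : (S.erase s).card = S.card - 1 := card_erase_of_mem hs
  have h2 := L.sum_filter_eq_pow_mul fC (S.erase s) hZ (fun σ => P σ ∧ σ s = 1)
    (fun z hz σ c => by
      have hzu : z ≠ u := fun e => huS (e ▸ (mem_erase.1 hz).2)
      have hzv : z ≠ v := fun e => hvS (e ▸ (mem_erase.1 hz).2)
      have hzs : z ≠ s := (mem_erase.1 hz).1
      simp only [hP, Function.update_of_ne hzu.symm, Function.update_of_ne hzv.symm, Function.update_of_ne hzs.symm,
        hΦS z (mem_erase.1 hz).2 σ c])
    (fun _ _ => 0) (fun _ _ _ _ _ _ => rfl)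
  have h3 : ∑ σ ∈ univ.filter (fun σ : V → Fin 3 => (P σ ∧ σ s = 1) ∧ ∀ z ∈ S.erase s, σ z = (0 : Fin 3)), fC (L.ctypeM σ)
      = ∑ σ ∈ univ.filter (fun σ : V → Fin 3 => (P σ ∧ σ s = 1) ∧ ∀ z ∈ S.erase s, σ z = (0 : Fin 3)), fC ((K.isolate y).ctypeM σ) := by
    refine sum_congr rfl fun σ hσ => ?_
    obtain ⟨⟨hPσ, -⟩, hz⟩ := (mem_filter.1 hσ).2
    have hu : σ u = 0 := hPσ.1.1
    rw [hL, K.ctypeM_peelContract_of_const y u (S.erase s) huy (fun h => huS ((mem_erase.1 h).2)) (fun h => hyS ((mem_erase.1 h).2)) σ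
      (fun z hz' => by rw [hz z hz', hu])]
  have h4 : ∑ σ ∈ univ.filter (fun σ : V → Fin 3 => (P σ ∧ σ s = 1) ∧ ∀ z ∈ S.erase s, σ z = (0 : Fin 3)), fC ((K.isolate y).ctypeM σ)
      = K.uvSumF Φ y S s u v := by
    have e4 : K.uvSumF Φ y S s u v = ∑ ρ ∈ univ.filter P, (if ρ s = 1 ∧ (∀ s' ∈ S, s' ≠ s → ρ s' = 0) then fC ((K.isolate y).ctypeM ρ) else 0) := rfl
    rw [e4, sum_filter, sum_filter]
    refine sum_congr rfl fun σ _ => ?_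
    by_cases hPσ : P σ
    · by_cases hQ : σ s = 1 ∧ ∀ s' ∈ S, s' ≠ s → σ s' = 0
      · rw [if_pos hPσ, if_pos hQ, if_pos ⟨⟨hPσ, hQ.1⟩, fun z hz => hQ.2 z (mem_erase.1 hz).2 (mem_erase.1 hz).1⟩]
      · rw [if_pos hPσ, if_neg hQ, if_neg (fun h => hQ ⟨h.1.2, fun s' hs' hne => h.2 s' (mem_erase.2 ⟨hne, hs'⟩)⟩)]
    · rw [if_neg hPσ, if_neg (fun h => hPσ h.1.1)]
  rw [h1, h2, h3, h4, hcard, ← mul_assoc]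
  congr 1
  have hc : 1 ≤ S.card := card_pos.2 ⟨s, hs⟩
  rw [← pow_succ']
  congr 1
  omega

/-- **THEOREM U, ROW BY ROW** (filtered form; memo FINDING-g54 §1/§3, FINDING-g53 §1): under the hypotheses of `TfunM_step_unpaired`, for EVERY predicate `Φ`
on colourings that ignores the colours on `S ∪ {y}`,
`2·3^{|S|}·T_Φ(K.isolate y) + 2·T_Φ(K.peelContract y S u) + 6·T_Φ((K.peelContract y (S∖w) w)⁺ᵘ) + Σ_{s∈S} T_Φ((K.peelContract y (S∖s) u).contractOne s v)
 ≤ 2·3^{|S|+1}·T_Φ(K)`.  Taking `Φ` = 'fixed colours off `S ∪ {y}`' this is the nonnegativity of every single ROW of the unpaired law; taking `Φ` = a weight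
class of `TI_{P,Q}` (far special points) it is the transfer of THEOREM U to the fractional-mark hierarchy. [this work] -/
theorem TfunF_step_unpaired (huv : u ≠ v) (hyu : y ≠ u) (hyv : y ≠ v) (hmark : K.mark y = 0) (hadj : K.mul y u ≠ 0) (hfar : K.mul y v = 0)
    (hS : ∀ w, w ∈ S ↔ (w ≠ u ∧ w ≠ v ∧ w ≠ y ∧ K.mul y w ≠ 0)) (htwo : 2 ≤ S.card) {w : V} (hw : w ∈ S)
    (hΦ : ∀ z, (z = y ∨ z ∈ S) → ∀ σ c, Φ (Function.update σ z c) ↔ Φ σ) :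
    2 * 3 ^ S.card * (K.isolate y).TfunF Φ u v + 2 * (K.peelContract y S u).TfunF Φ u v
      + 6 * ((K.peelContract y (S.erase w) w).addMark u 1).TfunF Φ u v
      + ∑ s ∈ S, ((K.peelContract y (S.erase s) u).contractOne s v).TfunF Φ u v
      ≤ 2 * 3 ^ (S.card + 1) * K.TfunF Φ u v := by
  have huS : u ∉ S := fun h => ((hS u).1 h).1 rfl
  have hvS : v ∉ S := fun h => ((hS v).1 h).2.1 rfl
  have hyS : y ∉ S := fun h => ((hS y).1 h).2.2.1 rfl
  have hΦy : ∀ σ c, Φ (Function.update σ y c) ↔ Φ σ := hΦ y (Or.inl rfl)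
  have hΦS : ∀ s ∈ S, ∀ σ c, Φ (Function.update σ s c) ↔ Φ σ := fun s hs => hΦ s (Or.inr hs)
  have h1 := K.sum_resU2_filter_eq Φ y S u v hyu.symm hyv.symm hΦy
  have h2 := sum_resU2_filter_nonneg Φ hS huv hyu hyv hmark hadj hfar htwo hΦS
  rw [h1] at h2
  have hA := K.TfunF_peelContract Φ y u v S hyu.symm huS hvS hyS hΦS
  have hB := K.TfunF_blockGraph Φ y u v S huS hvS hyS hΦS hw
  have hC : ∑ s ∈ S, ((K.peelContract y (S.erase s) u).contractOne s v).TfunF Φ u v = 3 ^ S.card * ∑ s ∈ S, K.uvSumF Φ y S s u v := by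
    rw [mul_sum]
    exact sum_congr rfl fun s hs => K.TfunF_uvGraph Φ y u v S hyu.symm huS hvS hyS hΦS hs
  have hpow : (3 : ℤ) ^ S.card = 3 * 3 ^ (S.card - 1) := by
    rw [← pow_succ']; congr 1; omega
  rw [hA, hB, hC, pow_succ]
  have hp : (0 : ℤ) ≤ 3 ^ (S.card - 1) := by positivity
  have hcell : 2 * (K.isolate y).TfunF Φ u v + 2 * K.allZeroSumF Φ y S u v + 2 * K.blockSumF Φ y S u v + ∑ s ∈ S, K.uvSumF Φ y S s u v
      ≤ 6 * K.TfunF Φ u v := by linarith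
  have key := mul_le_mul_of_nonneg_left hcell hp
  rw [hpow]
  nlinarith [key]

end FilterHeart

end MGraph

end Summit.CriticalPhenomena.PercolationContinuityZ3.Theorems.SunflowerPartition.Kempe
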